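import Summits.ABC.IUTFork.Charitable.Thm311D1Derive
import Summits.ABC.IUTFork.Charitable.Thm311D2Derive
import HarnessLib

/-!
# Branch D — CONCORDANCE of the two blind charitable re-typings of [IUTchIII] Thm. 3.11: the load-bearing clauses coincide

Proof-only file (D-0012; abc-iut cell, rung LADDER-ABC:A2.D; written by abc-iut-D1-prv AFTER abc-iut-D-ref's «D: BLIND LIFTED»
2026-08-26T06:41:04Z, as the deriver's cross-read; CLAIM posted 06:45:13Z; §2's general-index equivalence drafted by abc-iut-D1-cx
(staging/D/D1-cx/Thm311DConcordance.lean sha16 df2b94a20fe50cf7), D2-side lemmas cited BY NAME from abc-iut-D2-prv's `Thm311D2Derive` (p429322), who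
yielded the file 06:48:08Z). TAKES NO SIDE on [IUTchIII] Cor. 3.12 or on any author;
asserts nothing about print. Teams D1 (abc-iut-D1-typ, `Charitable/Thm311D1`, p428378/p429129) and D2 (abc-iut-D2-typ,
`Charitable/Thm311D2`, p428473) re-typed Theorem 3.11 (i)–(iii) + Rmk. 3.11.1 (S. Mochizuki, *Inter-universal Teichmüller theory III*,
kurims (May 2020) pp. 153–167) independently and blind to each other; both teams PROVED deliverable (a) (D1 `D1.S_of_charitable_1`
p428642; D2 `D2.pilotKummerIndRelated_of_charitable_2` p428699), each from ONE load-bearing clause reading the (iii)(c) final sentence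
(p. 158 l. 5–15) as a datum-level Kummer/link square, plus the permutation symmetry of (i) and (for D2) (ii)(b).

KERNEL CONCORDANCE (this file):
* the two typings' permutation clauses are the SAME term (`perm_iff_permSymmetric`, `Iff.rfl`) and so are their (ii)(b) splitting
  clauses (`splitting_iff_splittingKummer`, `Iff.rfl`) — two blind seats typed T8 (p. 154 l. 70 – p. 155 l. 9) and T11/T13 (p. 155
  l. 79 – p. 156 l. 26) identically over the frozen carriers;
* under those two shared clauses the LOAD-BEARING clauses are EQUIVALENT: D1's `D1.PartIII.linkKummer S qK P.n` («`qK` is the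
  splitting-monoid datum of a possibility `D′ ∈ ^{P.n+1,∘}ℜ^LGP`», link read `P.n → P.n+1`, étale datum) ⟺ abc-iut-w5-d068's
  `Cor312Vol.PilotKummerCompat S P qK` ⟺ D2's `D2.III_c_KummerLinkSquare S P.n qK` («`qK = Φ · Ψ^{Frob}_{(P.n−1,m)}`», link read
  `P.n−1 → P.n`, Frobenius-like datum) ⟺ D2's strong (IPL) gloss `D2.Rmk3111_iii_IPL S P.n qK` (`linkKummer_iff_pilotKummerCompat`,
  `linkKummer_iff_kummerLinkSquare`, `linkKummer_iff_ipl`). The opposite column conventions of the two teams (D1: `P.n` = domain of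
  the arrow; D2: `P.n` = codomain) are immaterial under the permutation symmetry.
* hence the two (a) theorems factor through ONE sentence — the datum-level square = the cell's `PilotKummerCompat` of record —
  and each team's typing yields the other's load-bearing clause (`kummerLinkSquare_of_charitable_1`, `linkKummer_of_charitable_2`).
So «is G an artefact of an uncharitable typing?» receives the SAME kernel answer from both blind teams: S follows from Thm. 3.11 as
charitably typed exactly through the datum-level reading of (iii)(c)'s final clause (whose faithfulness the referee grades), and that
reading is false at honest `j²`-volumes with `|log(q)| > 0` (D1 `charitable_1_false_of_honest`, D2 `charitable_2_false_of_honest`).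
Framing: locates / conditionally verifies; no abc claim; no side on any author; typed ≠ proved. [claim: Mochizuki2012, status: disputed]
-/

noncomputable section

open Set

namespace Summit.ABC.IUTFork.Charitable

open Thm311 Cor312 Cor312Vol Literature.IUT.LogThetaLattice

variable {T : ThetaIndex} (S : LatticeSituation T) (P : Cor312.Setting S.toSituation)
  (ρ : (∀ v : T.V, v ∈ T.Vbad → Set (S.L.StarPacket v)) → ∀ (j : T.Label) (vQ : T.VQ), Set (S.L.Packet j vQ))
  (qK : ∀ v : T.V, v ∈ T.Vbad → Set (S.L.StarPacket v))

/-! ## 1. Shared clauses: identical terms -/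

/-- The two blind typings' permutation-symmetry clauses (Thm. 3.11 (i), final portion) are the same term. [folklore] -/
theorem perm_iff_permSymmetric : D1.PartI.perm S ↔ D2.I_PermSymmetric S := Iff.rfl

/-- The two blind typings' (ii)(b) splitting-monoid clauses are the same term (= `Column.KummerB` at every column). [folklore] -/
theorem splitting_iff_splittingKummer : D1.PartII.splitting S ↔ D2.II_b_SplittingKummer S := Iff.rfl

/-! ## 2. The load-bearing clauses are equivalent under the shared clauses -/

/-- **D1's L2 ⟺ the cell's `PilotKummerCompat`** under the permutation symmetry and (ii)(b): «`qK = D′.Ψ` for a possibility `D′` of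
line `P.n+1`» iff «`qK = Φ · Ψ^{Frob}_{(P.n,m)}` for one `Φ ∈ ⟨(Ind1)∪(Ind2)⟩` and some `m`». [claim: Mochizuki2012, status: disputed] -/
theorem linkKummer_iff_pilotKummerCompat (hperm : D1.PartI.perm S) (hspl : D1.PartII.splitting S) :
    D1.PartIII.linkKummer S qK P.n ↔ PilotKummerCompat S P qK := by
  rw [D1.linkKummer_iff_of_perm S qK hperm P.n P.n]
  constructor
  · rintro ⟨D', hD', hq⟩
    obtain ⟨Φ, hΦ, hΨ⟩ := GluedMonoids.exists_closure_psi_eq_of_mem_RLGP (L := S.L) hD'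
    refine ⟨Φ, hΦ, 0, fun v hv => ?_⟩
    rw [hq, hΨ v hv, hspl P.n 0 v hv]
  · rintro ⟨Φ, hΦ, m, hq⟩
    refine ⟨(S.D P.n).map Φ, MRData.map_mem_RLGP _ hΦ, funext fun v => funext fun hv => ?_⟩
    rw [hq v hv, hspl P.n m v hv]
    rfl

/-- **CONCORDANCE: D1's load-bearing clause ⟺ D2's load-bearing clause, for EVERY pair of line indices** (drafted by
abc-iut-D1-cx): under (ii)(b) at every column and (i)'s permutation symmetry, team D1's `PartIII.linkKummer S qK n` (the q-datum IS the
splitting-monoid component of a possibility of line `n+1`) and team D2's `III_c_KummerLinkSquare S n′ qK` (the q-datum IS an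
⟨(Ind1)∪(Ind2)⟩-translate of a column-`m` Frobenius-like splitting monoid of line `n′−1`) are EQUIVALENT. [claim: Mochizuki2012, status: disputed] -/
theorem linkKummer_iff_kummerLinkSquare (hperm : D1.PartI.perm S) (hspl : D1.PartII.splitting S) (n n' : ℤ) :
    D1.PartIII.linkKummer S qK n ↔ D2.III_c_KummerLinkSquare S n' qK := by
  have hR : S.RLGP (n + 1) = S.RLGP (n' - 1) := (D1.perm_iff_multiradialCompat S).1 hperm _ _
  have hΨ : ∀ m, (S.col (n' - 1)).frobΨ m = (S.D (n' - 1)).Ψ := fun m => funext fun v => funext fun hv => hspl _ m v hv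
  constructor
  · rintro ⟨D', hD', hq⟩
    rw [hR] at hD'
    obtain ⟨Φ, hΦ, rfl⟩ := (MRData.mem_RLGP_iff _ _).1 hD'
    exact ⟨Φ, hΦ, 0, fun v hv => by rw [hq, hΨ 0]; rfl⟩
  · rintro ⟨Φ, hΦ, m, hq⟩
    refine ⟨(S.D (n' - 1)).map Φ, ?_, funext fun v => funext fun hv => by rw [hq v hv, hΨ m]; rfl⟩
    show (S.D (n' - 1)).map Φ ∈ S.RLGP (n + 1)
    rw [hR]
    exact MRData.map_mem_RLGP _ hΦ

/-- The same at the Corollary's line `P.n` on both sides, routed through `PilotKummerCompat` (D2's half is abc-iut-D2-prv's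
`D2.square_iff_pilotKummerCompat`) — an independent second proof of the `(P.n, P.n)` instance. [claim: Mochizuki2012, status: disputed] -/
theorem linkKummer_iff_kummerLinkSquare_at (hperm : D1.PartI.perm S) (hspl : D1.PartII.splitting S) :
    D1.PartIII.linkKummer S qK P.n ↔ D2.III_c_KummerLinkSquare S P.n qK := by
  rw [linkKummer_iff_pilotKummerCompat S P qK hperm hspl, D2.square_iff_pilotKummerCompat S P qK hperm hspl]

/-- **D1's L2 ⟺ D2's strong (IPL) gloss** `Rmk3111_iii_IPL` at line `P.n` under the permutation symmetry alone (the two differ by the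
line index and by `funext`). [claim: Mochizuki2012, status: disputed] -/
theorem linkKummer_iff_ipl (hperm : D1.PartI.perm S) : D1.PartIII.linkKummer S qK P.n ↔ D2.Rmk3111_iii_IPL S P.n qK := by
  rw [D1.linkKummer_iff_of_perm S qK hperm P.n P.n]
  exact ⟨fun ⟨D', hD', hq⟩ => ⟨D', hD', fun v hv => by rw [hq]⟩,
    fun ⟨D', hD', hq⟩ => ⟨D', hD', funext fun v => funext fun hv => hq v hv⟩⟩

/-! ## 3. Each typing yields the other's load-bearing clause; both (a) theorems factor through one sentence -/

/-- Team D1's official typing yields team D2's load-bearing clause at every line index. [claim: Mochizuki2012, status: disputed] -/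
theorem kummerLinkSquare_of_charitable_1 (h : D1.Thm311Charitable_1 S P qK) (n' : ℤ) : D2.III_c_KummerLinkSquare S n' qK :=
  (linkKummer_iff_kummerLinkSquare S qK h.1.1 h.2.1.2.1 P.n n').1 h.2.2.1

/-- Team D2's official typing (at any line index) yields team D1's load-bearing clause at every line index. [claim: Mochizuki2012, status: disputed] -/
theorem linkKummer_of_charitable_2 {n' : ℤ} (h : D2.Thm311Charitable_2 S n' qK) (n : ℤ) : D1.PartIII.linkKummer S qK n :=
  have hs := D2.charitable_2_square S h
  (linkKummer_iff_kummerLinkSquare S qK hs.1 hs.2.1 n n').2 hs.2.2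

/-- **Both (a) theorems factor through the cell's `PilotKummerCompat`** (abc-iut-w5-d068, p. 158 l. 5–14 read at the pilots' Kummer
data): either charitable typing gives it, and it gives S under (ii)(b) (`pilotKummerIndRelated_of_pilotKummerCompat`) — pins idle.
[claim: Mochizuki2012, status: disputed] -/
theorem both_factor_through_pilotKummerCompat :
    (D1.Thm311Charitable_1 S P qK → PilotKummerCompat S P qK) ∧
      (D2.Thm311Charitable_2 S P.n qK → PilotKummerCompat S P qK) ∧
      (D1.PartII.splitting S → PilotKummerCompat S P qK → PilotKummerIndRelated S P ρ qK) :=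
  ⟨fun h => (linkKummer_iff_pilotKummerCompat S P qK h.1.1 h.2.1.2.1).1 h.2.2.1,
    fun h => have hs := D2.charitable_2_square S h; D2.pilotKummerCompat_of_square S P qK hs.1 hs.2.1 hs.2.2,
    fun hspl hc => pilotKummerIndRelated_of_pilotKummerCompat S P ρ qK (hspl P.n) hc⟩


/-! ## 4. The other rungs agree too: hull (D1 L1 ↔ D2 Reading Y) and region/object (both ARE the residual S) -/

/-- **Hull rungs concordant**: under the three pins, team D1's L1 `PartIII.hull S P` ⟺ team D2's Reading Y = the cell's
`Cor312Vol.PilotKummerCompatHull S P ρ qK` (the q-pin rewrites `P.qRegion = ρ qK`; the link pin discharges L1's antecedent).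
[claim: Mochizuki2012, status: disputed] -/
theorem hull_iff_pilotKummerCompatHull (hpin : PinnedRegions3 S P ρ qK) :
    D1.PartIII.hull S P ↔ PilotKummerCompatHull S P ρ qK :=
  ⟨fun h j vQ => by rw [← hpin.1.2 j vQ]; exact h hpin.2 j vQ, fun h _ j vQ => by rw [hpin.1.2 j vQ]; exact h j vQ⟩

/-- **Region/object rungs concordant — both ARE S**: under the three pins, (i)-perm and (ii)(b), team D1's object-level clause
`PartIII.linkKummerObj S P` (D1 `linkKummerObj_iff_S`) and team D2's region-level square at line `P.n−1`
(D2 `regionSquare_iff_pilotKummerIndRelated`) are each equivalent to the residual `PilotKummerIndRelated`, hence to each other.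
[claim: Mochizuki2012, status: disputed] -/
theorem linkKummerObj_iff_regionSquare (hperm : D1.PartI.perm S) (hspl : D1.PartII.splitting S)
    (hpin : PinnedRegions3 S P ρ qK) :
    D1.PartIII.linkKummerObj S P ↔
      ∀ (j : T.Label) (vQ : T.VQ), ∃ Φ ∈ Subgroup.closure (S.L.Ind1Family ∪ S.L.Ind2Family), ∃ m : ℤ,
        ρ qK j vQ = Φ j vQ '' ρ ((S.col (P.n - 1)).frobΨ m) j vQ := by
  rw [D1.linkKummerObj_iff_S S P ρ qK hspl hpin, D2.regionSquare_iff_pilotKummerIndRelated S P ρ qK hperm hspl hpin.1.1.1]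

/-- **THE LADDERS AGREE** (packaged for the referee): under the shared (i)-perm and (ii)(b) clauses and the three pins, the two blind
typings' datum rungs coincide (and each gives S), their region/object rungs coincide with S, their hull rungs coincide (and give the
Statement under `BridgeHyps`, D1 `statement_of_charitableHull_1` / D2 `statement_of_charitable_2H`). [claim: Mochizuki2012, status: disputed] -/
theorem ladders_agree (hperm : D1.PartI.perm S) (hspl : D1.PartII.splitting S) (hpin : PinnedRegions3 S P ρ qK) :
    (D1.PartIII.linkKummer S qK P.n ↔ D2.III_c_KummerLinkSquare S P.n qK) ∧
      (D1.PartIII.linkKummer S qK P.n → PilotKummerIndRelated S P ρ qK) ∧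
      (D1.PartIII.linkKummerObj S P ↔ PilotKummerIndRelated S P ρ qK) ∧
      (D1.PartIII.hull S P ↔ PilotKummerCompatHull S P ρ qK) :=
  ⟨linkKummer_iff_kummerLinkSquare S qK hperm hspl P.n P.n, D1.S_of_perm_of_linkKummer S P ρ qK hperm,
    D1.linkKummerObj_iff_S S P ρ qK hspl hpin, hull_iff_pilotKummerCompatHull S P ρ qK hpin⟩

end Summit.ABC.IUTFork.Charitable

end
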